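import Literature.AlgebraicGeometry.ShimuraVarieties.KudlaRapoport2013.Sec2Defs                    -- ★ `sigmaInt`, `IsInertPrime`, `IsRamifiedPrime`, `diff0`
import Literature.AlgebraicGeometry.ShimuraVarieties.KudlaRapoport2013.Sec3ComplexUniformization  -- ★ `krForm`, `IsHermitianFor`, `HasSignatureAt`, `IsFullLattice`, `IsSelfDualFor`, `LatticeDatum`, `isometryStabilizer`
import Mathlib.NumberTheory.LSeries.DirichletContinuation
import Mathlib.NumberTheory.Padics.PadicNumbers
import HarnessLib

/-!
# Kudla–Rapoport (2013/2014), Part III «Eisenstein series»: §7 the theta integral, §8 the Siegel formula,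
# §9 the incoherent case, §10 representation densities — statements carpet (TKR-t05, block 4)

S. Kudla, M. Rapoport, *Special cycles on unitary Shimura varieties II: global theory*, J. reine angew. Math. 697
(2014) 91–157 [KudlaRapoport2013].  NUMBERING AND PAGES OF RECORD = arXiv:0912.3758**v2** (squad ruling R-1; the page images of
v2 are the squad kit `KR2013-arXivv2-pages.txt` sha16 5ca93424, pp. 30–41, read for this file; the held TeX `paper:arxiv-0912.3758` is
v1, whose §10 differs: v1's explicit Lemma 10.2 ∕ Prop. 10.3 ∕ Cor. 10.4 density formulas were REPLACED in v2 by Prop. 10.2 «independent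
of `a` and `b`», Cor. 10.3, Lemma 10.4 and Remark 10.5 — only the v2 statements are typed).  Pins are «(arXiv v2 p. N)».

Standing data: `k` an imaginary quadratic field (instance hypotheses as in ★ `Sec2Defs`), `σ` its nontrivial automorphism
(★ `Liu2021.AppendixC.conj ℚ k` on `k`, ★ `Sec2Defs.sigmaInt k` on `O_k`), `χ` «the global quadratic character attached to `k`» (p. 30),
hermitian spaces IN COORDINATES as in the squad's §3 file (★ `Sec3ComplexUniformization`: `V = kⁿ` with a Gram matrix `J`,
`(u, v) = krForm σ J u v`, linear in `u`, `σ`-linear in `v`; an `O_k`-lattice `L ⊆ kⁿ` is a `Submodule (𝓞 k) (Fin n → k)`; a hermitian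
lattice is a ★ `LatticeDatum k n = ⟨J, L⟩`; its isometry group `Γ_L` is ★ `isometryStabilizer σ ⟨J, L⟩`).

## What is TYPED (REAL = a definition with its body ∕ a closed named fact `def … : Prop`; ROW = a predicate on the posited datum)

* §7 (pp. 30–31).  (7.6) «`Ω(T, M_j) = {x ∈ M_jⁿ ∣ (x, x) = T}`» → `reprSet`; (7.2) «`mass(M) := Σ_j |Γ_j|⁻¹`» → `massOf`; (7.6)
  «`r_gen(T, M) = Σ_j |Γ_j|⁻¹ |Ω(T, M_j)|`» → `rGen`; (7.5) «`I(z; M) = mass(M)⁻¹ Σ_{T ∈ Herm_n(O_k)} r_gen(T, M) q^T`» → `thetaGenus` —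
  all REAL over a POSITED finite family `Ms : ι → LatticeDatum k n` standing for «`M_j` runs over representatives for the classes in
  the `G₁`-genus of `M`» (p. 31); the genus condition itself (local isometry at every `p`, i.e. `M_j = g_j(M ⊗ Ẑ) ∩ V(ℚ)`) needs the
  base-changed hermitian form on `V ⊗ ℚ_p` and is NOT typed — TODO(general form).  `q^T = e(tr(Tz))` and the hermitian upper
  half-space `{z ∈ M_n(ℂ) ∣ v(z) = (2i)⁻¹(z − ᵗz̄) > 0} ≅ D(W₀)` (p. 31) are the squad's §11–12 file's `qPow` ∕ `hermUpperHalfSpace`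
  (TKR-t02, `Sec11Sec12MainTheorem`); they are spelled inline here, not re-declared, to keep the import direction §7–10 ↛ §11.
* §8 (pp. 31–33).  «`χ` the global quadratic character attached to `k`» as a Dirichlet character → `IsQuadCharOf` (REAL predicate:
  conductor `|Δ|`, `χ(p) = −1` iff `p` inert, `+1` iff `p` split, for `p ∤ Δ`); footnote 7 «the superscript `S` indicates that the Euler
  factors for the primes in `S` are omitted» → `partialL` (Mathlib `DirichletCharacter.LFunction` times the removed Euler factors — the
  analytically continued function, so that the values at `s = 0` used in §9 make sense); (8.2) «`L^S(2s, n, χ) = ∏_{i=1}^n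
  L^S(2s + n − i + 1, χ^{n−i+1})`» → `partialLn`; its local factor at `p`, «`L_p(2s, n, χ)`» (Prop. 9.3) → `localLn`.
* §9 (pp. 33–36).  (9.2) «`Diff(T, V) = {p < ∞ ∣ χ_p(det T) = −χ_p(det V)}`» → `diff` (REAL: `χ_p(a) = +1` iff `a` is a norm from
  `k ⊗ ℚ_p` → `IsLocalNormAt`, modelled on the RSZ squad's ★ `Sec5GlobalIntegralModels.IsNormAt`); the three sentences after (9.2)
  «only ramified or inert primes can occur in this set», «if `T > 0`, then … `Diff(T, V)` has odd cardinality», «since `V` contains a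
  self dual lattice, an inert place `p` lies in `Diff(T, V)` if and only if `ord_p(det(T))` is odd» → named facts `KR2013_9_diff_subset`,
  `KR2013_9_diff_card_odd`, `KR2013_9_diff_inert_iff_diff0` (the last one IS the bridge to ★ `Sec2Defs.diff0`); «`S = 1_n` and
  `S' = diag(1_{n−1}, p)`», «`T ≃ diag(1_{n−2}, p^a, p^b)`» (Prop. 9.3) → `Sprime`, `Tdiag`; «`C_p = pⁿ α_p(S; S) ∕ α_p(S′; S′)`» (p. 34) →
  `Cp` (REAL through `repDensity`).  ROWS on the posited datum `EisDatum` (Eisenstein ∕ Whittaker values are BARE FUNCTIONS, see below):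
  the factorization «`E_T(h, s, Φ) = L^S(2s, n, χ)⁻¹ ∏_{v ∈ S} W_{T,v}(h_v, s, Φ_v)`» (pp. 32–33) → `KR2013_9_factorization`;
  **Lemma 9.1** (i)–(iii) → `KR2013_9_1`; **Proposition 9.3** (i)–(ii) → `KR2013_9_3`; the two displays of p. 34
  «`E′_T(h, 0, Φ) = W′_{T,p}(0, Φ_p) W_{T,p}(0, Φ′_p)⁻¹ · 2 I_T(h, φ′)`», «`E′_T(z, 0, Φ) = (−1)ⁿ μ_p(T) log(p) · C_p · 2 mass(L′)⁻¹
  r_gen(T, L′) · q^T`» → `KR2013_9_eisDeriv_theta`, `KR2013_9_eisDeriv_formula`; (8.7) for `(V′, L′)` «`2 mass(M)⁻¹ r_gen(T; M) q^T =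
  L^S(0, n, χ)⁻¹ ∏_{ℓ ∈ S_f} W_{T,ℓ}(1, 0, Φ_ℓ) · W_{T,∞}(h_z, 0, Φ^n_∞)`» → `KR2013_8_7`; p. 35 «`C_p · 2 mass(L′)⁻¹ = vol(G′₁(ℝ), dμ′₁)
  vol(K₁, dμ₁)`» → `KR2013_9_C_eq`; **Corollary 9.4** → `KR2013_9_4`; **Lemma 9.5** (with `χ(P^{n−1}(ℂ)) = n`) → `KR2013_9_5`.
  `μ_p(T) = ½ Σ_{ℓ=0}^{a} p^ℓ (a + b − 2ℓ + 1)` is the §11–12 file's `muP` (TKR-t02); spelled inline in the rows here.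
* §10 (pp. 36–41).  «`S[x]`» → `hermBracket`; (10.1) «`A_{p^k}(S, T) = {x ∈ M_{m,n}(O_k ∕ p^k O_k) ∣ S[x] ≡ T mod p^k Herm_n(O_k)^∨}`»,
  «`Herm_n(O_k)^∨ = {b ∈ Herm_n(k) ∣ tr(bc) ∈ O_k for all c ∈ Herm_n(O_k)}`», «`α_p(S, T) = lim_{k→∞} (p^{−k})^{n(2m−n)} |A_{p^k}(S, T)|`» →
  `repCountMod`, `repDensity` (REAL, for `S`, `T` with entries in `O_k` — the case of all uses in §9–§10; the print allows `O_{k,p}`-entries: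
  TODO(general form)); Prop. 10.1's «`S_r`» and «`e = ½ n(m + 2r) + ¼ n(n − 1)`» → `Sr`, `eExp`; named facts (odd inert `p`): p. 38
  «`α_p(S; S) = ∏_{i=1}^n (1 − (−1)^i p^{−i}) = L_p(0, n, χ)⁻¹`» (by Prop. 9.1 of [39]) → `KR2013_10_density_unimodular`; p. 38 «`α_p(S′; T) =
  α_p(S′; 1_{n−2}) α_p(S″; T″)`» (reduction, Cor. 9.12 of [39]) → `KR2013_10_reduction`; **Proposition 10.2** «`α_p(S″; T″)` is independent
  of `a` and `b`» (with the last line of its proof, p. 41: `= α_p(S″; S″)`) → `KR2013_10_2`; **Corollary 10.3** «for `n ≥ 2`, `α_p(S′; T) =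
  α_p(S′; S′)`» → `KR2013_10_3`; **Remark 10.5** «`α_p(S′; S′) = p (1 + p⁻¹) ∏_{r=1}^{n−1} (1 − (−1)^r p^{−r})`» ([11] Thm. 7.3) → `KR2013_10_5`.

## NOT TYPED (recorded): objects with no carrier in Mathlib ∕ the tree
the Weil representation `ω`, theta function `θ(g, h; φ)` and theta integral `I(h; φ)` (§7 p. 30), (7.1) the Gaussian on `V(ℝ)ⁿ`, (7.3)
`h_z` (depends on a choice of `a` with `v(z) = a ᵗā`), (7.4); Ichino's formula for `I_T`, (8.1) the convergence factors `λ_v⁻¹ =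
L_v(1, χ_v)` and the measures `d_{T,v}`, (8.3) the Whittaker integral, (8.4) (Weil index `γ_v`), (8.5) «`2 I_T(h; φ) = E_T(h, 0, Φ)`» and
(8.6) as separate rows (their consequences (8.7) and p. 34 are rows), (9.1) the classical incoherent Eisenstein series as a function (a
bare field `eisDerivClassical`), Remark 9.2 (a notation), the construction of `V′ = V^T` and `L′` (p. 34: posited as the genus family
`gen p`), the gauge forms and Tamagawa measures of pp. 35–36 and 38–41, Remark 9.6, **Proposition 10.1** «`W_{T,p}(r, Φ_p) = γ_p(V)ⁿ
|N(det S)|_p^{n∕2} |Δ|_p^e α_p(S_r; T)`» (its REAL ingredients `Sr`, `eExp`, `repDensity` are typed), (10.2)–(10.5), **Lemma 10.4**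
(i)–(iii) (volumes of `K_p` for gauge-form measures), Hironaka's explicit formula [17].

## INDEX of tree declarations this part of the paper names
`σ` = ★ `conj ℚ k` ∕ ★ `sigmaInt k`; «inert», «ramified» = ★ `IsInertPrime`, ★ `IsRamifiedPrime`; `Diff₀(T)` = ★ `diff0`; `(x, y)` = ★ `krForm`;
hermitian = ★ `IsHermitianFor`; «`sig(V) = (n−r, r)`» = ★ `HasSignatureAt τ J r`; self-dual lattice = ★ `IsFullLattice` ∧ ★ `IsSelfDualFor`;
`Γ_j` = ★ `isometryStabilizer`; `G₁ = U(V)` = ★ `unitaryGroupOfForm`; `L(s, χ)` = Mathlib `DirichletCharacter.LFunction`; `ℚ_p` = Mathlib `Padic`.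

## READINGS
R1 (coherent side in §9) the rows use (8.7) only for the definite space `V′ = V′(p)` with the lattice `L′` of p. 34, whose genus
representatives are the posited family `gen p`; `W_{T,ℓ}(·, Φ′_ℓ) = W_{T,ℓ}(·, Φ_ℓ)` for `ℓ ≠ p` (the fixed identification
`V′(𝔸_f^p) = V(𝔸_f^p)`, p. 34) and `Φ′_∞ = Φ^n_∞` (both Gaussians of signature `(n, 0)`), so one family of Whittaker fields serves.
R2 (places) a «sufficiently large finite set of places `S` including the archimedean place» is typed as a `Finset ℕ` of primes
containing the datum's threshold `S0` (the archimedean factor is written separately); «`T ≃ diag(1_{n−2}, p^a, p^b)` under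
`GL_n(O_{k,p})`» is typed for the diagonal representative `Tdiag n p a b` itself (special case; TODO(general form)).
R3 (junk) `diff T J` contains every prime when `det T ∉ ℚ` (never the case for hermitian `T`); `repDensity` is Mathlib `limUnder` (junk
if the limit did not exist; it stabilises) and uses truncated `2m − n` (all uses have `m ≥ n`); `Tdiag` needs `n ≥ 2`, `Sprime` `n ≥ 1`.

## References
* [KudlaRapoport2013] S. Kudla, M. Rapoport, *Special cycles on unitary Shimura varieties II: global theory*, J. reine angew.
  Math. 697 (2014), 91–157; arXiv:0912.3758v2 — §7 pp. 30–31, §8 pp. 31–33, §9 pp. 33–36, §10 pp. 36–41.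
* [39] = S. Kudla, M. Rapoport, *Special cycles on unitary Shimura varieties I. Unramified local theory*, Invent. math. 184 (2011)
  (Prop. 9.1, Cor. 9.12 quoted on p. 38); [11] = W. T. Gan, J.-K. Yu, *Group schemes and local densities*, Duke Math. J. 105 (2000)
  (Thm. 7.3 quoted in Remark 10.5); [22] = A. Ichino (regularized Siegel–Weil, unitary groups), Math. Z. 247 (2004).
-/

open scoped TensorProduct Matrix
open NumberField Filter
open Literature.NumberTheory.Automorphic.Liu2021.AppendixC (conj)
open Literature.AlgebraicGeometry.ShimuraVarieties.KudlaRapoport2013.Sec2Defs (sigmaInt IsInertPrime IsRamifiedPrime diff0)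
open Literature.AlgebraicGeometry.ShimuraVarieties.KudlaRapoport2013.Sec3ComplexUniformization
  (krForm IsHermitianFor HasSignatureAt IsFullLattice IsSelfDualFor LatticeDatum isometryStabilizer)

namespace Literature.AlgebraicGeometry.ShimuraVarieties.KudlaRapoport2013.Sec7to10EisensteinSide

section Explicit

variable (k : Type) [Field k] [NumberField k] [IsTotallyComplex k] [Algebra.IsQuadraticExtension ℚ k]

/-! ## §9 (9.2): the local characters `χ_p` and `Diff(T, V)` (REAL) -/

/-- **«`χ_p(a) = 1`»** for `a ∈ ℚ` and a prime `p` (the local component at `p` of «the global quadratic character attached to `k`»,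
p. 30, evaluated as in (9.2) p. 33): `a` is a norm from `k_p = ℚ_p ⊗_ℚ k`, i.e. `a ⊗ 1 = z z̄` for some `z ∈ ℚ_p ⊗_ℚ k`, `z̄ = (1 ⊗ σ)(z)`
(for `p` split in `k` every `a` is such a norm; same shape as the RSZ file's ★ `Sec5GlobalIntegralModels.IsNormAt`, with Mathlib `Padic`
in place of `adicCompletion`). REAL. [cite: KudlaRapoport2013, §9 (9.2) (arXiv v2 p. 33)] -/
def IsLocalNormAt (p : ℕ) [Fact p.Prime] (a : ℚ) : Prop :=
  ∃ z : ℚ_[p] ⊗[ℚ] k,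
    z * Algebra.TensorProduct.map (AlgHom.id ℚ ℚ_[p]) (conj ℚ k : k →ₐ[ℚ] k) z = algebraMap ℚ ℚ_[p] a ⊗ₜ[ℚ] (1 : k)

/-- **(9.2) `Diff(T, V) = {p < ∞ ∣ χ_p(det(T)) = −χ_p(det(V))}`** (p. 33) for `T ∈ Herm_n(k)` with `det(T) ≠ 0` and the hermitian space
`V = (kⁿ, J)` given by its Gram matrix `J` («`det(V)`» = the class of `det J`): the primes `p` at which exactly one of the rational numbers
`det T`, `det J` is a local norm (`χ_p` takes the values `±1` on `ℚ_p^×`).  For hermitian `T`, `J` the determinants are rational (fixed by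
`σ`), so the inner quantifiers bind their unique rational values (READING R3). REAL. [cite: KudlaRapoport2013, §9 (9.2) (arXiv v2 p. 33)] -/
def diff {n : ℕ} (T J : Matrix (Fin n) (Fin n) k) : Set ℕ :=
  {p | ∃ _hp : Fact p.Prime, ∀ dT dJ : ℚ, algebraMap ℚ k dT = T.det → algebraMap ℚ k dJ = J.det →
    ¬ (IsLocalNormAt k p dT ↔ IsLocalNormAt k p dJ)}

/-- **[KR2013 §9, after (9.2)] CLOSED: «Note that only ramified or inert primes can occur in this set.»** (p. 33) — for hermitian
`T`, `J ∈ M_n(k)` with nonzero determinants, every `p ∈ Diff(T, V)` is ramified or inert in `k` (★ `IsRamifiedPrime`, ★ `IsInertPrime`):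
at a split prime every nonzero rational number is a local norm. [cite: KudlaRapoport2013, §9 (9.2) (arXiv v2 p. 33)] -/
def KR2013_9_diff_subset : Prop :=
  ∀ {n : ℕ} (T J : Matrix (Fin n) (Fin n) k), IsHermitianFor (conj ℚ k : k →+* k) T → IsHermitianFor (conj ℚ k : k →+* k) J →
    T.det ≠ 0 → J.det ≠ 0 → ∀ p ∈ diff k T J, IsRamifiedPrime k p ∨ IsInertPrime k p

/-- **[KR2013 §9, after (9.2)] CLOSED: «if `T > 0`, then `1 = χ_∞(det(T)) = −χ_∞(det(V))`, and hence `Diff(T, V)` has odd cardinality, due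
to the product formula (1.2).»** (p. 33) — here `V` has signature `(n−1, 1)`, `n ≥ 1` (standing hypothesis of §9), and `T > 0` is
positive definite; signatures at the complex embedding `τ` are ★ `HasSignatureAt τ · r` (`r` negative signs).
[cite: KudlaRapoport2013, §9 (9.2) (arXiv v2 p. 33)] -/
def KR2013_9_diff_card_odd : Prop :=
  ∀ {n : ℕ} (τ : k →+* ℂ) (T J : Matrix (Fin n) (Fin n) k), 1 ≤ n → HasSignatureAt τ T 0 → HasSignatureAt τ J 1 →
    (diff k T J).Finite ∧ Odd (diff k T J).ncard

/-- **[KR2013 §9, after (9.2)] CLOSED: «since `V` contains a self dual lattice, an inert place `p` lies in `Diff(T, V)` if and only if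
`ord_p(det(T))` is odd.»** (p. 33) — for `T ∈ Herm_n(O_k)` with `det T ≠ 0` and `V = (kⁿ, J)` hermitian containing a self-dual `O_k`-lattice
`L` (★ `IsFullLattice`, ★ `IsSelfDualFor`), an inert `p` lies in `Diff(T, V)` iff it lies in ★ `Sec2Defs.diff0 T` («the set of inert primes `p`
such that `ord_p det(T)` is odd», Prop. 2.22 ∕ §11) — the bridge between (9.2) and `Diff₀`. [cite: KudlaRapoport2013, §9 (9.2) (arXiv v2 p. 33)] -/
def KR2013_9_diff_inert_iff_diff0 : Prop :=
  ∀ {n : ℕ} (T : Matrix (Fin n) (Fin n) (𝓞 k)) (J : Matrix (Fin n) (Fin n) k) (L : Submodule (𝓞 k) (Fin n → k)),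
    IsHermitianFor (sigmaInt k : 𝓞 k →+* 𝓞 k) T → T.det ≠ 0 → IsHermitianFor (conj ℚ k : k →+* k) J →
    IsFullLattice L → IsSelfDualFor (conj ℚ k : k →+* k) J L →
      ∀ p : ℕ, IsInertPrime k p → (p ∈ diff k (T.map (algebraMap (𝓞 k) k)) J ↔ p ∈ diff0 k T)

/-! ## §8: the quadratic character `χ` and the partial `L`-functions (REAL) -/

/-- **«`χ` is the global quadratic character attached to `k`»** (p. 30), as a Dirichlet character `χ` modulo `|Δ|` (Mathlib
`DirichletCharacter ℂ N`): `N = |Δ|` and, for `p ∤ Δ`, `χ(p) = −1` iff `p` is inert and `χ(p) = +1` iff `p` is split (= not inert);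
`χ(p) = 0` for `p ∣ N` is automatic.  A REAL predicate pinning down `χ` uniquely. [cite: KudlaRapoport2013, §7 (arXiv v2 p. 30)] -/
def IsQuadCharOf {N : ℕ} (χ : DirichletCharacter ℂ N) : Prop :=
  N = (NumberField.discr k).natAbs ∧
    ∀ p : ℕ, p.Prime → ¬ p ∣ N → (χ (p : ZMod N) = -1 ↔ IsInertPrime k p) ∧ (χ (p : ZMod N) = 1 ↔ ¬ IsInertPrime k p)

end Explicit

section Analytic

/-- **`L^S(s, ψ)`** for a Dirichlet character `ψ` and a finite set of primes `S` (footnote 7, p. 32: «the superscript `S` indicates that the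
Euler factors for the primes in `S` are omitted»): the analytically continued `L(s, ψ)` (Mathlib `DirichletCharacter.LFunction`) multiplied
by the removed Euler factors `∏_{p ∈ S} (1 − ψ(p) p^{−s})`. REAL. [cite: KudlaRapoport2013, §8 (8.2) (arXiv v2 p. 32)] -/
noncomputable def partialL (S : Finset ℕ) {N : ℕ} [NeZero N] (ψ : DirichletCharacter ℂ N) (s : ℂ) : ℂ :=
  ψ.LFunction s * ∏ p ∈ S, (1 - ψ (p : ZMod N) * (p : ℂ) ^ (-s))

/-- **(8.2) «`L^S(2s, n, χ) = ∏_{i=1}^n L^S(2s + n − i + 1, χ^{n−i+1})`»** (p. 32), as a function of `s` (the argument printed `2s`).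
REAL. [cite: KudlaRapoport2013, §8 (8.2) (arXiv v2 p. 32)] -/
noncomputable def partialLn (S : Finset ℕ) {N : ℕ} [NeZero N] (χ : DirichletCharacter ℂ N) (s : ℂ) (n : ℕ) : ℂ :=
  ∏ i ∈ Finset.Icc 1 n, partialL S (χ ^ (n - i + 1)) (2 * s + ((n - i + 1 : ℕ) : ℂ))

/-- **«`L_p(2s, n, χ)`, the local factor at `p` of the `L`-function (8.2)»** (Prop. 9.3 (i), p. 34): `∏_{i=1}^n (1 − χ(p)^{n−i+1}
p^{−(2s+n−i+1)})⁻¹`. REAL. [cite: KudlaRapoport2013, §9 Proposition 9.3 (arXiv v2 p. 34)] -/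
noncomputable def localLn (p : ℕ) {N : ℕ} (χ : DirichletCharacter ℂ N) (s : ℂ) (n : ℕ) : ℂ :=
  ∏ i ∈ Finset.Icc 1 n, (1 - χ (p : ZMod N) ^ (n - i + 1) * (p : ℂ) ^ (-(2 * s + ((n - i + 1 : ℕ) : ℂ))))⁻¹

end Analytic

section Coordinates

variable {k : Type} [Field k] [NumberField k] [IsTotallyComplex k] [Algebra.IsQuadraticExtension ℚ k]

/-! ## §7: representation numbers, mass and the genus theta series (REAL over a posited family of genus representatives) -/

/-- **(7.6) «`Ω(T, M_j) = {x ∈ M_jⁿ ∣ (x, x) = T}`»** (p. 31) for a hermitian lattice `M_j = ⟨J, L⟩` (★ `LatticeDatum`) and `T ∈ M_m(k)`: the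
`m`-tuples `x = [x₁, …, x_m]` of lattice vectors with moment matrix `((x_i, x_j))_{ij} = T`, `(u, v) = krForm σ J u v` (★). REAL.
[cite: KudlaRapoport2013, §7 (7.6) (arXiv v2 p. 31)] -/
def reprSet {n m : ℕ} (X : LatticeDatum k n) (T : Matrix (Fin m) (Fin m) k) : Set (Fin m → Fin n → k) :=
  {x | (∀ i, x i ∈ X.L) ∧ ∀ i j, krForm (conj ℚ k : k →+* k) X.J (x i) (x j) = T i j}

/-- **(7.2) «`mass(M) := Σ_j |Γ_j|⁻¹`», «the classical mass of the genus of `M`»** (p. 31), for a POSITED finite family `Ms` of hermitian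
lattices standing for the representatives `M_j` of the classes in the `G₁`-genus of `M`, `Γ_j` = ★ `isometryStabilizer σ (Ms j)` («the group of
isometries of the hermitian lattice `M_j`», p. 31; finite for definite `V`). REAL in `Ms` (the genus condition is NOT typed).
[cite: KudlaRapoport2013, §7 (7.2) (arXiv v2 p. 31)] -/
noncomputable def massOf {ι : Type} [Fintype ι] {n : ℕ} (Ms : ι → LatticeDatum k n) : ℚ :=
  ∑ j, ((Nat.card (isometryStabilizer (conj ℚ k : k →+* k) (Ms j)) : ℚ))⁻¹

/-- **(7.6) «`r_gen(T; M) = Σ_j |Γ_j|⁻¹ |Ω(T; M_j)|`», the representation number** (p. 31; the `T`-th Fourier coefficient of (7.5)), for the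
posited family `Ms` of genus representatives. REAL in `Ms`. [cite: KudlaRapoport2013, §7 (7.6) (arXiv v2 p. 31)] -/
noncomputable def rGen {ι : Type} [Fintype ι] {n m : ℕ} (Ms : ι → LatticeDatum k n) (T : Matrix (Fin m) (Fin m) k) : ℚ :=
  ∑ j, ((Nat.card (isometryStabilizer (conj ℚ k : k →+* k) (Ms j)) : ℚ))⁻¹ * (Nat.card (reprSet (Ms j) T) : ℚ)

/-- **(7.5) «`I(z; M) = mass(M)⁻¹ Σ_{T ∈ Herm_n(O_k)} r_gen(T; M) q^T`»**, «the analytic genus invariant» (p. 31, footnote 6), with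
`q^T = e(tr(Tz))`, `T` read in `ℂ` through the embedding `τ` (a `tsum` over all `T ∈ M_n(O_k)`: non-hermitian `T` have `Ω(T, M_j) = ∅`).
REAL in `Ms`. [cite: KudlaRapoport2013, §7 (7.5) (arXiv v2 p. 31)] -/
noncomputable def thetaGenus {ι : Type} [Fintype ι] {n : ℕ} (Ms : ι → LatticeDatum k n) (τ : k →+* ℂ)
    (z : Matrix (Fin n) (Fin n) ℂ) : ℂ :=
  ((massOf Ms : ℚ) : ℂ)⁻¹ *
    ∑' T : Matrix (Fin n) (Fin n) (𝓞 k),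
      ((rGen Ms (T.map (algebraMap (𝓞 k) k)) : ℚ) : ℂ) *
        Complex.exp (2 * Real.pi * Complex.I * ((T.map fun a => τ (a : k)) * z).trace)

/-! ## §10: representation densities (REAL) -/

/-- **«`S[x]`»** for `S ∈ Herm_m(O_k)` and `x ∈ M_{m,n}(O_k)` ((10.1) p. 36): the moment matrix `ᵗx S x̄ ∈ M_n(O_k)` of the columns of `x`
(p. 40: «`S = (x, x) = (va, va) = ᵗa (v, v) ā`»). REAL. [cite: KudlaRapoport2013, §10 (10.1) (arXiv v2 p. 36)] -/
noncomputable def hermBracket {m n : ℕ} (S : Matrix (Fin m) (Fin m) (𝓞 k)) (x : Matrix (Fin m) (Fin n) (𝓞 k)) : Matrix (Fin n) (Fin n) (𝓞 k) :=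
  xᵀ * S * x.map (sigmaInt k)

/-- **(10.1) «`|A_{p^k}(S, T)|`, `A_{p^k}(S, T) = {x ∈ M_{m,n}(O_k ∕ p^k O_k) ∣ S[x] ≡ T mod p^k Herm_n(O_k)^∨}`, where `Herm_n(O_k)^∨ = {b ∈ Herm_n(k) ∣
tr(bc) ∈ O_k for all c ∈ Herm_n(O_k)}`»** (p. 36; exponent written `ℓ` here): the number of classes modulo `p^ℓ M_{m,n}(O_k)` of integral
`x` with `tr((S[x] − T) c) ∈ p^ℓ O_k` for every hermitian `c ∈ M_n(O_k)` (the condition depends only on `x mod p^ℓ`). REAL (global integral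
`S`, `T`; the print's `O_{k,p}`-entries: TODO(general form)). [cite: KudlaRapoport2013, §10 (10.1) (arXiv v2 p. 36)] -/
noncomputable def repCountMod (p ℓ : ℕ) {m n : ℕ} (S : Matrix (Fin m) (Fin m) (𝓞 k)) (T : Matrix (Fin n) (Fin n) (𝓞 k)) : ℕ :=
  Nat.card ((fun x : Matrix (Fin m) (Fin n) (𝓞 k) => x.map (Ideal.Quotient.mk (Ideal.span {((p : 𝓞 k) ^ ℓ)}))) ''
    {x | ∀ c : Matrix (Fin n) (Fin n) (𝓞 k), IsHermitianFor (sigmaInt k : 𝓞 k →+* 𝓞 k) c →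
      ((hermBracket S x - T) * c).trace ∈ Ideal.span {((p : 𝓞 k) ^ ℓ)}})

/-- **(10.1) «`α_p(S, T) = lim_{k→∞} (p^{−k})^{n(2m−n)} |A_{p^k}(S, T)|`», the representation density** (p. 36), as Mathlib `limUnder atTop`
of the real sequence (READING R3). REAL. [cite: KudlaRapoport2013, §10 (10.1) (arXiv v2 p. 36)] -/
noncomputable def repDensity (p : ℕ) {m n : ℕ} (S : Matrix (Fin m) (Fin m) (𝓞 k)) (T : Matrix (Fin n) (Fin n) (𝓞 k)) : ℝ :=
  limUnder atTop fun ℓ : ℕ => (p : ℝ) ^ (-((ℓ * (n * (2 * m - n)) : ℕ) : ℤ)) * (repCountMod p ℓ S T : ℝ)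

/-- **«`S_r = (( , , 1_r), ( , S, ), (1_r, , ))`»** (Prop. 10.1, p. 37): the hermitian matrix of `L_p ⊕ L_{r,r}` (Rallis's interpolation, `V^{[r]} =
V ⊕ V_{r,r}`), block anti-diagonal identity corners around `S`, on the index type `Fin r ⊕ (Fin m ⊕ Fin r)` (Mathlib `Matrix.fromBlocks`). REAL.
[cite: KudlaRapoport2013, §10 Proposition 10.1 (arXiv v2 p. 37)] -/
def Sr {R : Type} [Zero R] [One R] {m : ℕ} (S : Matrix (Fin m) (Fin m) R) (r : ℕ) :
    Matrix (Fin r ⊕ Fin m ⊕ Fin r) (Fin r ⊕ Fin m ⊕ Fin r) R :=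
  Matrix.fromBlocks (0 : Matrix (Fin r) (Fin r) R)
    (Matrix.of fun a j => Sum.elim (fun _ => (0 : R)) (fun b => if a = b then 1 else 0) j)
    (Matrix.of fun i b => Sum.elim (fun _ => (0 : R)) (fun a => if a = b then 1 else 0) i)
    (Matrix.fromBlocks S 0 0 (0 : Matrix (Fin r) (Fin r) R))

/-- **«`e = ½ n(m + 2r) + ¼ n(n − 1)`»**, the exponent of `|Δ|_p` in Prop. 10.1 (p. 37; p. 38 «`e = n(m+2r)∕2 + n(n−1)∕4`»). REAL.
[cite: KudlaRapoport2013, §10 Proposition 10.1 (arXiv v2 p. 37)] -/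
def eExp (n m r : ℕ) : ℚ := (1 / 2 : ℚ) * n * (m + 2 * r) + (1 / 4 : ℚ) * n * ((n : ℚ) - 1)

end Coordinates

section Densities

variable (k : Type) [Field k] [NumberField k] [IsTotallyComplex k] [Algebra.IsQuadraticExtension ℚ k]

/-- **«`S′ = diag(1_{n−1}, p)`»** (Prop. 9.3, p. 34; «the matrix for the hermitian form of `V′_p` on the lattice `Λ♯`, `Λ` a vertex of type 1», p. 38),
in `M_n(O_k)`; for `n = 2` this is «`S″ = diag(1, p)`» (p. 38). REAL. [cite: KudlaRapoport2013, §9 Proposition 9.3 (arXiv v2 p. 34)] -/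
def Sprime (n p : ℕ) : Matrix (Fin n) (Fin n) (𝓞 k) :=
  Matrix.diagonal fun i => if (i : ℕ) + 1 = n then (p : 𝓞 k) else 1

/-- **«`T ≃ diag(1_{n−2}, p^a, p^b)`»** (Prop. 9.3, p. 34), the diagonal representative in `M_n(O_k)` (`n ≥ 2`); for `n = 2` this is
«`T″ = diag(p^a, p^b)`» (p. 38). REAL. [cite: KudlaRapoport2013, §9 Proposition 9.3 (arXiv v2 p. 34)] -/
def Tdiag (n p a b : ℕ) : Matrix (Fin n) (Fin n) (𝓞 k) :=
  Matrix.diagonal fun i => if (i : ℕ) + 2 = n then (p : 𝓞 k) ^ a else if (i : ℕ) + 1 = n then (p : 𝓞 k) ^ b else 1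

/-- **«`C_p = pⁿ α_p(S; S) ∕ α_p(S′; S′)`»** (p. 34), `S = 1_n`, `S′ = diag(1_{n−1}, p)`. REAL (through `repDensity`).
[cite: KudlaRapoport2013, §9 Proposition 9.3 (arXiv v2 p. 34)] -/
noncomputable def Cp (p n : ℕ) : ℝ :=
  (p : ℝ) ^ n * repDensity p (1 : Matrix (Fin n) (Fin n) (𝓞 k)) (1 : Matrix (Fin n) (Fin n) (𝓞 k)) /
    repDensity p (Sprime k n p) (Sprime k n p)

/-- **[KR2013 §10, p. 38] CLOSED** (proof of Prop. 9.3, «by Proposition 9.1 of [39]»): for an odd inert prime `p` and `S = 1_n`, «`α_p(S; S) =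
∏_{i=1}^n (1 − (−1)^i p^{−i}) = L_p(0, n, χ)⁻¹`» — the second equality for «the global quadratic character `χ` attached to `k`» (`IsQuadCharOf`,
`χ(p) = −1`). [cite: KudlaRapoport2013, §10 proof of Proposition 9.3 (arXiv v2 p. 38)] -/
def KR2013_10_density_unimodular : Prop :=
  ∀ (p n : ℕ), IsInertPrime k p → p ≠ 2 →
    repDensity p (1 : Matrix (Fin n) (Fin n) (𝓞 k)) (1 : Matrix (Fin n) (Fin n) (𝓞 k)) =
        ∏ i ∈ Finset.Icc 1 n, (1 - (-1 : ℝ) ^ i * (p : ℝ) ^ (-(i : ℤ))) ∧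
      ∀ {N : ℕ} (χ : DirichletCharacter ℂ N), IsQuadCharOf k χ →
        ((repDensity p (1 : Matrix (Fin n) (Fin n) (𝓞 k)) (1 : Matrix (Fin n) (Fin n) (𝓞 k)) : ℝ) : ℂ) = (localLn p χ 0 n)⁻¹

/-- **[KR2013 §10, p. 38] CLOSED** («the analogue of the reduction formula of Proposition 9.3 of [39], which follows immediately from
Corollary 9.12 of [39], implies that»): for an odd inert `p`, `n ≥ 2`, `S′ = diag(1_{n−1}, p)`, `T = diag(1_{n−2}, p^a, p^b)` with
`0 ≤ a < b`, `a + b` odd (the setting of Prop. 9.3), «`α_p(S′; T) = α_p(S′; 1_{n−2}) α_p(S″; T″)`» with `S″ = diag(1, p)`, `T″ = diag(p^a, p^b)`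
(READING R2: the diagonal representative). [cite: KudlaRapoport2013, §10 proof of Proposition 9.3 (arXiv v2 p. 38)] -/
def KR2013_10_reduction : Prop :=
  ∀ (p n a b : ℕ), IsInertPrime k p → p ≠ 2 → 2 ≤ n → a < b → Odd (a + b) →
    repDensity p (Sprime k n p) (Tdiag k n p a b) =
      repDensity p (Sprime k n p) (1 : Matrix (Fin (n - 2)) (Fin (n - 2)) (𝓞 k)) *
        repDensity p (Sprime k 2 p) (Tdiag k 2 p a b)

/-- **[KR2013, Proposition 10.2] CLOSED: «The quantity `α_p(S″; T″)` is independent of `a` and `b`.»** (p. 38), `S″ = diag(1, p)`,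
`T″ = diag(p^a, p^b)`, for an odd inert (unramified) `p`; typed with the last line of its proof (p. 41): «for any `T″ = diag(p^a, p^b)` with
`a, b ∈ ℤ_{≥0}` with `a + b` odd … `α_p(S″; T″) = α_p(S″; S″)`, as claimed». [cite: KudlaRapoport2013, §10 Proposition 10.2 (arXiv v2 pp. 38, 41)] -/
def KR2013_10_2 : Prop :=
  ∀ (p a b : ℕ), IsInertPrime k p → p ≠ 2 → Odd (a + b) →
    repDensity p (Sprime k 2 p) (Tdiag k 2 p a b) =
      repDensity p (Sprime k 2 p) (Sprime k 2 p)

/-- **[KR2013, Corollary 10.3] CLOSED: «For `n ≥ 2`, `α_p(S′; T) = α_p(S′; S′)`.»** (p. 38) — in the setting of Prop. 9.3: `p` odd inert,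
`S′ = diag(1_{n−1}, p)`, `T = diag(1_{n−2}, p^a, p^b)`, `0 ≤ a < b`, `a + b` odd (READING R2). [cite: KudlaRapoport2013, §10 Corollary 10.3 (arXiv v2 p. 38)] -/
def KR2013_10_3 : Prop :=
  ∀ (p n a b : ℕ), IsInertPrime k p → p ≠ 2 → 2 ≤ n → a < b → Odd (a + b) →
    repDensity p (Sprime k n p) (Tdiag k n p a b) =
      repDensity p (Sprime k n p) (Sprime k n p)

/-- **[KR2013, Remark 10.5] CLOSED: «the value `α_p(S′; S′) = p · (1 + p⁻¹) · ∏_{r=1}^{n−1} (1 − (−1)^r p^{−r})` is obtained from the general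
formula in [11], Theorem 7.3.»** (p. 41), `S′ = diag(1_{n−1}, p) ∈ M_n(O_k)`, `n ≥ 1`, `p` odd inert ([11] = Gan–Yu 2000).
[cite: KudlaRapoport2013, §10 Remark 10.5 (arXiv v2 p. 41)] -/
def KR2013_10_5 : Prop :=
  ∀ (p n : ℕ), IsInertPrime k p → p ≠ 2 → 1 ≤ n →
    repDensity p (Sprime k n p) (Sprime k n p) =
      (p : ℝ) * (1 + (p : ℝ)⁻¹) * ∏ r ∈ Finset.Icc 1 (n - 1), (1 - (-1 : ℝ) ^ r * (p : ℝ) ^ (-(r : ℤ)))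

end Densities

/-! ## §8–§9: the posited Eisenstein-side datum and the printed assertions as ROWS (predicates on the datum) -/

section Rows

variable (k : Type) [Field k] [NumberField k] [IsTotallyComplex k] [Algebra.IsQuadraticExtension ℚ k]

/-- **The posited datum of [KudlaRapoport2013] §8–§9** for the incoherent Eisenstein series `E(h, s, Φ)`, `Φ = Φ(s, L)` (§9 p. 33), attached to a
hermitian space `V = (kⁿ, J)` of signature `(n−1, 1)` containing the self-dual lattice `L`.  REAL fields: `τ` (the complex embedding), `J`, `L`,
the Dirichlet character `χ` modulo the parameter `N` (to satisfy `IsQuadCharOf`, so `N = |Δ|`), the threshold `S0` of «sufficiently large» finite sets of primes (READING R2), for each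
prime `p` a finite family `gen p` of hermitian lattices = representatives of the `G′₁`-genus of the lattice `L′` in the definite space `V′ = V′(p)`
(p. 34: `L′ ⊗ Ẑ^p = L ⊗ Ẑ^p`, `L′_p = Λ♯`), the constants `C` (Cor. 9.4) and `χ(G₁(ℚ)∖(D × G₁(𝔸_f)∕K₁))` (Lemma 9.5).  ⟨CARRIER⟩ fields (BARE
FUNCTIONS, junk off their printed domain): `H` (the adelic group `H(𝔸) = U(n, n)(𝔸)` as a parameter type) with `hz z = h_z` (7.3) and `one = 1`;
`eisCoeff h T s = E_T(h, s, Φ)`, `eisCoeffDeriv h T = E′_T(h, 0, Φ)`, `eisDerivClassical z T = E′_T(z, 0, L)` ((9.1), (9.3)); the local Whittaker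
functions `whittFin p h T s = W_{T,p}(h_p, s, Φ_p)`, `whittInf h T s = W_{T,∞}(h_∞, s, Φ^n_∞)`, their central derivatives `whittFinDeriv`,
`whittInfDeriv`, and `whittMod p h T s = W_{T,p}(h_p, s, Φ′_p)` for the modified section at `p` (Prop. 9.3 (ii)); `gammaFin p = γ_p(V)` (10.3);
`thetaCoeffPrime p h T = I_T(h; φ′)`, the `T`-th coefficient of the theta integral of `(V′(p), φ′)` (p. 34).  Nothing is asserted.
[cite: KudlaRapoport2013, §9 (arXiv v2 pp. 33–35)] -/
structure EisDatum (n N : ℕ) : Type 1 where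
  /-- REAL: the complex embedding `τ : k → ℂ`. -/
  τ : k →+* ℂ
  /-- REAL: the Gram matrix `J` of `V` (signature `(n−1, 1)`). -/
  J : Matrix (Fin n) (Fin n) k
  /-- REAL: the self-dual lattice `L ⊂ V`. -/
  L : Submodule (𝓞 k) (Fin n → k)
  /-- REAL: the quadratic character `χ` of `k` as a Dirichlet character modulo `N` (= `|Δ|`, a parameter of the datum). -/
  χ : DirichletCharacter ℂ N
  /-- REAL: threshold for «a sufficiently large finite set of places `S`». -/
  S0 : Finset ℕ
  /-- REAL: number of classes in the `G′₁`-genus of `L′ = L′(p)`. -/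
  genCard : ℕ → ℕ
  /-- REAL-typed, posited: representatives of the classes in the genus of `L′(p)` (p. 34). -/
  gen : (p : ℕ) → Fin (genCard p) → LatticeDatum k n
  /-- REAL: `C = vol(G′₁(ℝ), dμ′₁) vol(K₁, dμ₁)` (Cor. 9.4). -/
  C : ℝ
  /-- REAL: `χ(G₁(ℚ)∖(D × G₁(𝔸_f)∕K₁))`, the Gauss–Bonnet integral (Lemma 9.5). -/
  eulerCharSh : ℚ
  /-- ⟨CARRIER⟩ parameter type for `h ∈ H(𝔸)`. -/
  H : Type
  /-- ⟨CARRIER⟩ `z ↦ h_z` (7.3). -/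
  hz : Matrix (Fin n) (Fin n) ℂ → H
  /-- ⟨CARRIER⟩ `h = 1` (Remark 9.2: `W_{T,p}(s, Φ_p) = W_{T,p}(1, s, Φ_p)`). -/
  one : H
  /-- ⟨CARRIER⟩ `E_T(h, s, Φ)`. -/
  eisCoeff : H → Matrix (Fin n) (Fin n) k → ℂ → ℂ
  /-- ⟨CARRIER⟩ `E′_T(h, 0, Φ)`. -/
  eisCoeffDeriv : H → Matrix (Fin n) (Fin n) k → ℂ
  /-- ⟨CARRIER⟩ `z ↦ E′_T(z, 0, L)`, the classical series (9.1) ∕ (9.3). -/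
  eisDerivClassical : Matrix (Fin n) (Fin n) ℂ → Matrix (Fin n) (Fin n) k → ℂ
  /-- ⟨CARRIER⟩ `W_{T,p}(h_p, s, Φ_p)`. -/
  whittFin : ℕ → H → Matrix (Fin n) (Fin n) k → ℂ → ℂ
  /-- ⟨CARRIER⟩ `W_{T,∞}(h_∞, s, Φ^n_∞)`. -/
  whittInf : H → Matrix (Fin n) (Fin n) k → ℂ → ℂ
  /-- ⟨CARRIER⟩ `W′_{T,p}(h_p, 0, Φ_p)`. -/
  whittFinDeriv : ℕ → H → Matrix (Fin n) (Fin n) k → ℂ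
  /-- ⟨CARRIER⟩ `W′_{T,∞}(h_∞, 0, Φ^n_∞)`. -/
  whittInfDeriv : H → Matrix (Fin n) (Fin n) k → ℂ
  /-- ⟨CARRIER⟩ `W_{T,p}(h_p, s, Φ′_p)` (modified section at `p`). -/
  whittMod : ℕ → H → Matrix (Fin n) (Fin n) k → ℂ → ℂ
  /-- ⟨CARRIER⟩ `γ_p(V)`, the Weil index (10.3). -/
  gammaFin : ℕ → ℂ
  /-- ⟨CARRIER⟩ `I_T(h; φ′)` for `(V′(p), φ′)` (p. 34). -/
  thetaCoeffPrime : ℕ → H → Matrix (Fin n) (Fin n) k → ℂ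

variable {k} {n N : ℕ} [NeZero N]

/-- **[KR2013 §8–§9] ROW: «`E_T(h, s, Φ) = L^S(2s, n, χ)⁻¹ · ∏_{v ∈ S} W_{T,v}(h_v, s, Φ_v)`, for a sufficiently large finite set `S` of places
including the archimedean place … We assume that `S` contains `Diff(T, V)`»** (pp. 32–33), for `T` with `det T ≠ 0` (READING R2: `S` = the
finite primes, `S ⊇ S0 ∪ Diff(T, V)`, archimedean factor separate). [cite: KudlaRapoport2013, §9 (arXiv v2 p. 33)] -/
def KR2013_9_factorization (D : EisDatum k n N) : Prop :=
  ∀ (T : Matrix (Fin n) (Fin n) k) (h : D.H) (s : ℂ) (S : Finset ℕ), T.det ≠ 0 → D.S0 ⊆ S → (∀ p ∈ diff k T D.J, p ∈ S) →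
    D.eisCoeff h T s = (partialLn S D.χ s n)⁻¹ * (∏ p ∈ S, D.whittFin p h T s) * D.whittInf h T s

/-- **[KR2013, Lemma 9.1] ROW.** (p. 33) «(i) If `T ∈ Herm_n(k) > 0` and `|Diff(T, V)| > 1`, then `E′_T(h, 0, Φ) = 0`.  (ii) If `T ∈ Herm_n(k) > 0`
and `Diff(T, V) = {p}`, then `E′_T(h, 0, Φ) = W′_{T,p}(h_p, 0, Φ_p) · L^S(0, n, χ)⁻¹ · ∏_{v ∈ S, v ≠ p} W_{T,v}(h_v, 0, Φ_v)`.  (iii) If `Diff(T, V)` is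
empty, so that `sig(T) = (n − r, r)` for `r` odd, then `E′_T(h, 0, Φ) = W′_{T,∞}(h_∞, 0, Φ^n_∞) · L^S(0, n, χ)⁻¹ · ∏_{v ∈ S, v ≠ ∞} W_{T,v}(h_v, 0, Φ_v)`.»
(`T > 0` = ★ `HasSignatureAt D.τ T 0`; `S` as in READING R2.) [cite: KudlaRapoport2013, §9 Lemma 9.1 (arXiv v2 p. 33)] -/
def KR2013_9_1 (D : EisDatum k n N) : Prop :=
  ∀ (T : Matrix (Fin n) (Fin n) k) (h : D.H), IsHermitianFor (conj ℚ k : k →+* k) T → T.det ≠ 0 →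
    (HasSignatureAt D.τ T 0 → 1 < (diff k T D.J).ncard → D.eisCoeffDeriv h T = 0) ∧
    (∀ p : ℕ, HasSignatureAt D.τ T 0 → diff k T D.J = {p} → ∀ S : Finset ℕ, D.S0 ⊆ S → p ∈ S →
      D.eisCoeffDeriv h T =
        D.whittFinDeriv p h T * ((partialLn S D.χ 0 n)⁻¹ * (∏ ℓ ∈ S.erase p, D.whittFin ℓ h T 0) * D.whittInf h T 0)) ∧
    (diff k T D.J = ∅ → ∀ S : Finset ℕ, D.S0 ⊆ S →
      D.eisCoeffDeriv h T = D.whittInfDeriv h T * ((partialLn S D.χ 0 n)⁻¹ * ∏ ℓ ∈ S, D.whittFin ℓ h T 0))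

/-- **[KR2013, Proposition 9.3] ROW.** (p. 34) «For `T ∈ Herm_n(O_k) > 0` with `Diff(T, V) = {p}` for an odd inert prime `p`, suppose that, under
the action of `GL_n(O_{k,p})`, `T ≃ diag(1_{n−2}, p^a, p^b)`, `0 ≤ a < b`.  Let `S = 1_n` and `S′ = diag(1_{n−1}, p)`.  (i) … `W′_{T,p}(0, Φ_p) =
γ_p(V)ⁿ α_p(S; S) μ_p(T) log p`, where `μ_p(T) = ½ Σ_{ℓ=0}^{a} p^ℓ (a + b − 2ℓ + 1)` … (ii) … `W_{T,p}(0, Φ′_p) = (−1)ⁿ γ_p(V)ⁿ p^{−n} α_p(S′; S′)`.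
In particular, this quantity is nonzero and independent of `T`.» (READING R2: `T = Tdiag n p a b`; `μ_p` spelled inline = TKR-t02's `muP`;
`W(0, ·) = W(1, 0, ·)` by Remark 9.2.) [cite: KudlaRapoport2013, §9 Proposition 9.3 (arXiv v2 p. 34)] -/
def KR2013_9_3 (D : EisDatum k n N) : Prop :=
  ∀ (p a b : ℕ), IsInertPrime k p → p ≠ 2 → 2 ≤ n → a < b →
    HasSignatureAt D.τ ((Tdiag k n p a b).map (algebraMap (𝓞 k) k)) 0 →
    diff k ((Tdiag k n p a b).map (algebraMap (𝓞 k) k)) D.J = {p} →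
      D.whittFinDeriv p D.one ((Tdiag k n p a b).map (algebraMap (𝓞 k) k)) =
          D.gammaFin p ^ n * (repDensity p (1 : Matrix (Fin n) (Fin n) (𝓞 k)) (1 : Matrix (Fin n) (Fin n) (𝓞 k)) : ℂ) *
            (((1 / 2 : ℚ) * ∑ l ∈ Finset.range (a + 1), (p : ℚ) ^ l * ((a : ℚ) + b - 2 * l + 1) : ℚ) : ℂ) * (Real.log p : ℂ) ∧
        D.whittMod p D.one ((Tdiag k n p a b).map (algebraMap (𝓞 k) k)) 0 =
          (-1 : ℂ) ^ n * D.gammaFin p ^ n * (p : ℂ) ^ (-(n : ℤ)) *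
            (repDensity p (Sprime k n p) (Sprime k n p) : ℂ) ∧
        D.whittMod p D.one ((Tdiag k n p a b).map (algebraMap (𝓞 k) k)) 0 ≠ 0

/-- **[KR2013 §9, p. 34, first display after Prop. 9.3] ROW: «Using the nonvanishing in (ii), we can write `E′_T(h, 0, Φ) = W′_{T,p}(0, Φ_p)
W_{T,p}(0, Φ′_p)⁻¹ · L^S(0, n, χ)⁻¹ · ∏_{v ∈ S} W_{T,v}(h_v, 0, Φ′_v) = W′_{T,p}(0, Φ_p) W_{T,p}(0, Φ′_p)⁻¹ · 2 I_T(h, φ′)`»** (the second equality;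
setting of Prop. 9.3, READING R2). [cite: KudlaRapoport2013, §9 Proposition 9.3 (arXiv v2 p. 34)] -/
def KR2013_9_eisDeriv_theta (D : EisDatum k n N) : Prop :=
  ∀ (p a b : ℕ) (h : D.H), IsInertPrime k p → p ≠ 2 → 2 ≤ n → a < b →
    HasSignatureAt D.τ ((Tdiag k n p a b).map (algebraMap (𝓞 k) k)) 0 →
    diff k ((Tdiag k n p a b).map (algebraMap (𝓞 k) k)) D.J = {p} →
      D.eisCoeffDeriv h ((Tdiag k n p a b).map (algebraMap (𝓞 k) k)) =
        D.whittFinDeriv p D.one ((Tdiag k n p a b).map (algebraMap (𝓞 k) k)) /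
            D.whittMod p D.one ((Tdiag k n p a b).map (algebraMap (𝓞 k) k)) 0 *
          (2 * D.thetaCoeffPrime p h ((Tdiag k n p a b).map (algebraMap (𝓞 k) k)))

/-- **[KR2013 (8.7)] ROW, «the fundamental identity `2 mass(M)⁻¹ r_gen(T; M) q^T = L^S(0; n; χ)⁻¹ · ∏_{ℓ ∈ S_f} W_{T,ℓ}(1, 0, Φ_ℓ) · W_{T,∞}(h_z, 0, Φ^n_∞)`
for a sufficiently large set of primes `S = S_f ∪ {∞}`»** (p. 33), applied (READING R1) to the definite space `V′ = V′(p)` with the lattice `L′`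
whose genus representatives are the posited family `D.gen p` (REAL `massOf`, `rGen`), `T ∈ Herm_n(O_k)` with `det T ≠ 0` (§8), `q^T = e(tr(T^τ z))`; at `ℓ ≠ p` the
section is `Φ_ℓ`, at `p` it is `Φ′_p`. [cite: KudlaRapoport2013, §8 (8.7) (arXiv v2 p. 33)] -/
def KR2013_8_7 (D : EisDatum k n N) : Prop :=
  ∀ (p : ℕ) (T : Matrix (Fin n) (Fin n) (𝓞 k)) (z : Matrix (Fin n) (Fin n) ℂ) (S : Finset ℕ),
    IsInertPrime k p → p ≠ 2 → (T.map (algebraMap (𝓞 k) k)).det ≠ 0 → D.S0 ⊆ S → p ∈ S →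
      2 * ((massOf (D.gen p) : ℚ) : ℂ)⁻¹ * ((rGen (D.gen p) (T.map (algebraMap (𝓞 k) k)) : ℚ) : ℂ) *
          Complex.exp (2 * Real.pi * Complex.I * ((T.map fun a => D.τ (a : k)) * z).trace) =
        (partialLn S D.χ 0 n)⁻¹ * (∏ ℓ ∈ S.erase p, D.whittFin ℓ D.one (T.map (algebraMap (𝓞 k) k)) 0) *
          D.whittMod p D.one (T.map (algebraMap (𝓞 k) k)) 0 * D.whittInf (D.hz z) (T.map (algebraMap (𝓞 k) k)) 0

/-- **[KR2013 §9, p. 34, last display] ROW: «Then, using (8.7) and Proposition 9.3, we obtain the expression `E′_T(z, 0, Φ) = (−1)ⁿ μ_p(T) log(p) ·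
C_p · 2 mass(L′)⁻¹ r_gen(T, L′) · q^T`, where `C_p = pⁿ α_p(S; S) ∕ α_p(S′; S′)`»** — REAL `Cp`, `massOf`, `rGen` (family `D.gen p`), `μ_p(T)` inline;
setting of Prop. 9.3 (READING R2). [cite: KudlaRapoport2013, §9 Proposition 9.3 (arXiv v2 p. 34)] -/
def KR2013_9_eisDeriv_formula (D : EisDatum k n N) : Prop :=
  ∀ (p a b : ℕ) (z : Matrix (Fin n) (Fin n) ℂ), IsInertPrime k p → p ≠ 2 → 2 ≤ n → a < b →
    HasSignatureAt D.τ ((Tdiag k n p a b).map (algebraMap (𝓞 k) k)) 0 →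
    diff k ((Tdiag k n p a b).map (algebraMap (𝓞 k) k)) D.J = {p} →
      D.eisDerivClassical z ((Tdiag k n p a b).map (algebraMap (𝓞 k) k)) =
        (-1 : ℂ) ^ n * (((1 / 2 : ℚ) * ∑ l ∈ Finset.range (a + 1), (p : ℚ) ^ l * ((a : ℚ) + b - 2 * l + 1) : ℚ) : ℂ) *
          (Real.log p : ℂ) * (Cp k p n : ℂ) *
          (2 * ((massOf (D.gen p) : ℚ) : ℂ)⁻¹ *
            ((rGen (D.gen p) ((Tdiag k n p a b).map (algebraMap (𝓞 k) k)) : ℚ) : ℂ)) *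
          Complex.exp (2 * Real.pi * Complex.I *
            (((Tdiag k n p a b).map fun x => D.τ (x : k)) * z).trace)

/-- **[KR2013 §9, p. 35] ROW: «By (iii) of Lemma 10.4, we have `C_p · vol(K′_{1,p}, dμ′₁) = vol(K_{1,p}, dμ₁)`.  Thus `C_p · 2 mass(L′)⁻¹ = vol(G′₁(ℝ), dμ′₁)
vol(K₁, dμ₁)`.  As we will see in a moment, the quantity `vol(G′₁(ℝ), dμ′₁)` is independent of `p`»** — with Cor. 9.4's `C = vol(G′₁(ℝ), dμ′₁) vol(K₁, dμ₁)`,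
for every odd inert `p`. [cite: KudlaRapoport2013, §9 Corollary 9.4 (arXiv v2 p. 35)] -/
def KR2013_9_C_eq (D : EisDatum k n N) : Prop :=
  ∀ p : ℕ, IsInertPrime k p → p ≠ 2 → Cp k p n * (2 * ((massOf (D.gen p) : ℚ) : ℝ)⁻¹) = D.C

/-- **[KR2013, Corollary 9.4] ROW: «For `T ∈ Herm_n(O_k) > 0` with `Diff(T, V) = {p}` for an odd inert prime `p`, suppose that `T` satisfies the
condition of Proposition 9.3.  Then `E′_T(z, 0, L) = (−1)ⁿ C · μ_p(T) log(p) · r_gen(T, L′) · q^T`, where `L′` is obtained from `L` as explained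
just before Proposition 9.3 and `C = vol(G′₁(ℝ), dμ′₁) vol(K₁, dμ₁)`.»** (p. 35; READING R2, `r_gen(T, L′) = rGen (D.gen p) T`.)
[cite: KudlaRapoport2013, §9 Corollary 9.4 (arXiv v2 p. 35)] -/
def KR2013_9_4 (D : EisDatum k n N) : Prop :=
  ∀ (p a b : ℕ) (z : Matrix (Fin n) (Fin n) ℂ), IsInertPrime k p → p ≠ 2 → 2 ≤ n → a < b →
    HasSignatureAt D.τ ((Tdiag k n p a b).map (algebraMap (𝓞 k) k)) 0 →
    diff k ((Tdiag k n p a b).map (algebraMap (𝓞 k) k)) D.J = {p} →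
      D.eisDerivClassical z ((Tdiag k n p a b).map (algebraMap (𝓞 k) k)) =
        (-1 : ℂ) ^ n * (D.C : ℂ) * (((1 / 2 : ℚ) * ∑ l ∈ Finset.range (a + 1), (p : ℚ) ^ l * ((a : ℚ) + b - 2 * l + 1) : ℚ) : ℂ) *
          (Real.log p : ℂ) *
          ((rGen (D.gen p) ((Tdiag k n p a b).map (algebraMap (𝓞 k) k)) : ℚ) : ℂ) *
          Complex.exp (2 * Real.pi * Complex.I *
            (((Tdiag k n p a b).map fun x => D.τ (x : k)) * z).trace)

/-- **[KR2013, Lemma 9.5] ROW: «`2 C⁻¹ = (−1)^{n−1} · χ(P^{n−1}(ℂ))⁻¹ · χ(G₁(ℚ)∖(D × G₁(𝔸_f)∕K₁))`, where, for an arithmetic group `Γ` of isometries of the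
`n − 1` ball `D`, `χ(Γ∖D) := ∫_{Γ∖D} Ω` is the integral of the Gauss–Bonnet form `Ω`»** (p. 35; Remark 9.6: for torsion-free `Γ` this is the Euler
characteristic, `P^{n−1}(ℂ)` is the compact dual of `D` and `(−1)^{n−1} χ(Γ∖D) > 0`) — with `χ(P^{n−1}(ℂ)) = n` (REAL), `n ≥ 1`.
[cite: KudlaRapoport2013, §9 Lemma 9.5 (arXiv v2 p. 35)] -/
def KR2013_9_5 (D : EisDatum k n N) : Prop :=
  1 ≤ n → 2 * D.C⁻¹ = (-1 : ℝ) ^ (n - 1) * (n : ℝ)⁻¹ * (D.eulerCharSh : ℝ)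

end Rows

end Literature.AlgebraicGeometry.ShimuraVarieties.KudlaRapoport2013.Sec7to10EisensteinSide
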